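import Literature.NumberTheory.GaloisRepresentations.GlobalReciprocityArtinThetaModPowers
import Literature.NumberTheory.GaloisRepresentations.ContinuousCharactersAbelianization
import Literature.NumberTheory.GaloisRepresentations.ContinuousCharactersBiduality
import Literature.AnabelianGeometry.AbsoluteAnabelian.LocalResidueMapQmodZ
import HarnessLib

/-!
# Every compatible family of functionals on the `ℤ/m`-characters of the finite abelian layers `L ⊆ F̄` is
# evaluation at `ψ_{L|F}(x)` for ONE idèle `x` (Pontryagin biduality of `Γ_F^{ab}` + `θ : C_F ↠ Γ_F^{ab}`)
# — the surjectivity of Milne's `α¹(Γ_F, ℤ/m)` at the layers (Milne I Thm. 1.8 (b); Neukirch III (7.12); Serre XIII §1)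

Topic `NumberTheory/GaloisRepresentations`; namespace `Literature.NumberTheory.GaloisRepresentations`.  Definitions with
bodies (the continuous character `layerCocycle L χ : Γ_F → ℚ/ℤ` of a layer character, its descent `layerCharacter L χ`
to `Γ_F^{ab}`, and the structure `LayerDescent` = "a layer `L` and a `ℤ/m`-character of `Gal(L/F)` through which a
character of `Γ_F^{ab}` killed on `m`-th powers factors along `θ`") and theorems; NO named fact, no `sorry`, no instance,
no notation; number fields in `Type`.

Milne I Thm. 1.8 (b) asks that `α¹(U, ℤ/m) : Ext¹_U(ℤ/m, C) → H¹(U, ℤ/m)^*` be BIJECTIVE.  For the idèle class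
formation `(Γ_F, C̄)`, with `H¹(Γ_F, ℤ/m)` read as the union of the layers `Hom(Gal(L/F), ℤ/m)` over the finite
abelian `L ⊆ F̄` (door-c4's (d)), a functional on `H¹(Γ_F, ℤ/m)` is a COMPATIBLE FAMILY `Φ_L : Hom(Gal(L/F), ℤ/m) → ℤ/m`
(additive; `Φ_L χ = Φ_{L'} χ'` whenever `χ ∘ res_L = χ' ∘ res_{L'}` on `Γ_F`), and surjectivity of `α¹` says that every
such family is `χ ↦ χ(ψ_{L|F} x)` for one idèle `x` (then `= −m · inv_{L/F}(ι[x] ∪ β_m[χ])`, door-c6 g14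
`classInvAll_baseCup_bockstein_eq_artinIdeleMap`).  Proof: a character `χ̄` of `Γ_F^{ab}` killed on `m`-th powers
DESCENDS to a layer (`exists_layerDescent`: `ker(χ̄ ∘ θ)` is open of finite index in `C_F`, existence theorem in
kernel form `exists_ker_artinMapFamily_le`, door-c6 g13); `Φ` of the descent is well defined (compatibility read through
`Γ_F ↠ Gal(L/F)`, `restrictNormalHom_eq_of_absGaloisAbProj_eq`) and additive (compositum `L ⊔ L'`, the tree's
`isAbelianGalois_sup`); extended to all continuous characters of `Γ_F^{ab}` by the injectivity of `ℚ/ℤ` (Mathlib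
`CharacterModule.dual_surjective_of_injective`), it is evaluation at some `g ∈ Γ_F^{ab}` (door-c6 g11
`exists_forall_character_apply_eq`, compactness), and `g = θ(x̄)` (`artinTheta_surjective`); on the layers
`θ(x̄)|_L = ψ_{L|F}(x)` (`restrictNormalHom_eq_of_absGaloisAbProj_eq`).

* §1 `layerCocycle`, `layerCharacter` (+ `_apply` lemmas, `layerCharacter_pow_eq_zero`).
* §2 `LayerDescent`, **`exists_layerDescent`**, `LayerDescent.apply_absRestrictNormalHom`, `layerDescent_self`.
* §3 **`exists_idele_forall_layer_character_eq`** — the surjectivity of `α¹(Γ_F, ℤ/m)` at the layers.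

HONEST FRAMING: classical (Pontryagin duality + global class field theory) in the tree's currency; no case of BSD /
Poitou–Tate.  Written for Route A (A5) of crux `AnticycControlAdditiveK` (cell bsd-schneider), companion of
`GlobalReciprocityModPowersLayers` (injectivity at the layers).

## References
* J. S. Milne, *Arithmetic Duality Theorems*, 2nd ed. (2006), Ch. I Thm. 1.8 (b). [MilneADT2006]
* J. Neukirch, *Class Field Theory — The Bonn Lectures* (2013), Part III Thm. (7.12), §6 (6.13)–(6.14). [Neukirch2013]
* J.-P. Serre, *Local Fields*, GTM 67 (1979), XIII §1 (Pontryagin duality for profinite abelian groups). [SerreLocalFields1979]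
* J. W. S. Cassels, A. Fröhlich (eds.), *Algebraic Number Theory* (1967), Ch. VII §5.1 (B), (D), §5.4–5.6. [CasselsFrohlichANT1967]
-/

noncomputable section

open scoped NumberField
open NumberField Field Function

namespace Literature.NumberTheory.GaloisRepresentations

open _root_.TopRep _root_.ContRepresentation _root_.ContinuousCohomology
open Literature.AnabelianGeometry.AbsoluteAnabelian.Prop121vii

variable {F : Type} [Field F] [NumberField F]

/-! ## §1. A layer character as a continuous character of `Γ_F` and of `Γ_F^{ab}` -/

section LayerCharacter

variable (m : ℕ) [NeZero m] (L : IntermediateField F (AlgebraicClosure F)) [FiniteDimensional F L] [IsGalois F L]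
  (χ : Additive (L ≃ₐ[F] L) →+ ZMod m)

/-- The homomorphism `γ ↦ χ(γ|_L)/m : Γ_F → ℚ/ℤ` (into `Multiplicative QModZCoeff`). [cite: SerreLocalFields1979, XIII §1] -/
def layerMonoidHom : absoluteGaloisGroup F →* Multiplicative QModZCoeff.{0} where
  toFun γ := Multiplicative.ofAdd (ULift.up (zmodToQmodZ m (χ (Additive.ofMul (absRestrictNormalHom L γ)))))
  map_one' := by rw [map_one, ofMul_one, map_zero, map_zero]; rfl
  map_mul' a b := by rw [map_mul, ofMul_mul, map_add, map_add]; rfl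

omit [NumberField F] in
/-- `layerMonoidHom` is continuous: its kernel contains the open subgroup `Gal(F̄/L)`.
[cite: SerreLocalFields1979, XIII §1] -/
theorem continuous_layerMonoidHom : Continuous (layerMonoidHom m L χ) := by
  refine MonoidHom.continuous_of_isOpen_ker _ (Subgroup.isOpen_mono ?_ (isOpen_ker_absRestrictNormalHom L))
  intro γ hγ
  rw [MonoidHom.mem_ker] at hγ ⊢
  change Multiplicative.ofAdd (ULift.up (zmodToQmodZ m (χ (Additive.ofMul (absRestrictNormalHom L γ))))) = 1
  rw [hγ, ofMul_one, map_zero, map_zero]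
  rfl

/-- **The continuous character `γ ↦ χ(γ|_L)/m` of `Γ_F`** attached to a `ℤ/m`-character of a finite Galois layer `L ⊆ F̄`
(a continuous `1`-cocycle of the trivial module `QModZCoeff`). [cite: SerreLocalFields1979, XIII §1] -/
def layerCocycle : contOneCocycles (ContinuousRep.trivial (absoluteGaloisGroup F) ℤ QModZCoeff.{0}).toTopRep :=
  ⟨⟨fun γ => ULift.up (zmodToQmodZ m (χ (Additive.ofMul (absRestrictNormalHom L γ)))),
      (continuous_toAdd.comp (continuous_layerMonoidHom m L χ)).congr fun _ => rfl⟩,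
    fun a b => by
      change ULift.up (zmodToQmodZ m (χ (Additive.ofMul (absRestrictNormalHom L (a * b))))) =
        ULift.up (zmodToQmodZ m (χ (Additive.ofMul (absRestrictNormalHom L a)))) +
          ULift.up (zmodToQmodZ m (χ (Additive.ofMul (absRestrictNormalHom L b))))
      rw [map_mul, ofMul_mul, map_add, map_add]
      rfl⟩

omit [NumberField F] in
/-- Unfolding `layerCocycle`. [cite: SerreLocalFields1979, XIII §1] -/
@[simp] theorem layerCocycle_apply (γ : absoluteGaloisGroup F) :
    (layerCocycle m L χ).1 γ = ULift.up (zmodToQmodZ m (χ (Additive.ofMul (absRestrictNormalHom L γ)))) := rfl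

/-- **The character `χ(·|_L)/m` of `Γ_F^{ab}`** (descent of `layerCocycle` along `Γ_F → Γ_F^{ab}`, the tree's
`contOneCocycles.descendAb`). [cite: SerreLocalFields1979, XIII §1] -/
def layerCharacter :
    contOneCocycles (ContinuousRep.trivial (absoluteGaloisGroupAbelianization F) ℤ QModZCoeff.{0}).toTopRep :=
  contOneCocycles.descendAb (layerCocycle m L χ)

omit [NumberField F] in
/-- `layerCharacter (γ̄) = χ(γ|_L)/m`. [cite: SerreLocalFields1979, XIII §1] -/
@[simp] theorem layerCharacter_apply_absGaloisAbProj (γ : absoluteGaloisGroup F) :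
    (layerCharacter m L χ).1 (absGaloisAbProj F γ) =
      ULift.up (zmodToQmodZ m (χ (Additive.ofMul (absRestrictNormalHom L γ)))) := rfl

omit [NumberField F] in
/-- `layerCharacter` is killed on `m`-th powers. [cite: SerreLocalFields1979, XIII §1] -/
theorem layerCharacter_pow_eq_zero (g : absoluteGaloisGroupAbelianization F) : (layerCharacter m L χ).1 (g ^ m) = 0 := by
  obtain ⟨γ, rfl⟩ := QuotientGroup.mk_surjective g
  rw [← QuotientGroup.mk_pow]
  change (layerCharacter m L χ).1 (absGaloisAbProj F (γ ^ m)) = 0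
  rw [layerCharacter_apply_absGaloisAbProj, map_pow, ofMul_pow, map_nsmul, nsmul_eq_mul, ZMod.natCast_self, zero_mul,
    map_zero]
  rfl

end LayerCharacter

/-! ## §2. Descent of a character of `Γ_F^{ab}` killed on `m`-th powers to a finite abelian layer -/

section Descent

variable (m : ℕ) [NeZero m]

/-- **A layer descent** of a continuous character `χ̄ : Γ_F^{ab} → ℚ/ℤ`: a finite abelian `L ⊆ F̄` and a `ℤ/m`-character
`χ` of `Gal(L/F)` with `χ(ψ̄_{L|F} c)/m = χ̄(θ c)` for every idèle class `c` (`θ` = the universal norm residue symbol).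
[cite: Neukirch2013, Part III §6 (6.13), (6.14)] -/
structure LayerDescent
    (χbar : contOneCocycles (ContinuousRep.trivial (absoluteGaloisGroupAbelianization F) ℤ QModZCoeff.{0}).toTopRep) where
  /-- the layer -/
  L : IntermediateField F (AlgebraicClosure F)
  /-- finiteness -/
  fd : FiniteDimensional F L
  /-- abelianity -/
  ab : IsAbelianGalois F L
  /-- the layer character -/
  χ : Additive (L ≃ₐ[F] L) →+ ZMod m
  /-- `χ(ψ̄_L c)/m = χ̄(θ c)` -/
  spec : ∀ c : ideleGroup F ⧸ principalIdeles F,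
    zmodToQmodZ m (χ (Additive.ofMul (artinMapFamily F artinReciprocity_character_holds L c))) =
      (χbar.1 ((isCompatibleSystem_artinMapFamily (K := F) artinReciprocity_character_holds).theta c)).down

/-- **An element of `ℚ/ℤ` killed by `m` lies in `(1/m)ℤ/ℤ`.** [cite: SerreLocalFields1979, XIV §1] -/
private theorem exists_zmodToQmodZ_eq_of_nsmul_eq_zero' {q : AddCircle (1 : ℚ)} (hq : m • q = 0) :
    ∃ k : ZMod m, zmodToQmodZ m k = q := by
  induction q using QuotientAddGroup.induction_on with
  | H r =>
    have h' : ((m • r : ℚ) : AddCircle (1 : ℚ)) = 0 := by rw [AddCircle.coe_nsmul]; exact hq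
    obtain ⟨n, hn⟩ := (AddCircle.coe_eq_zero_iff (1 : ℚ)).1 h'
    rw [zsmul_eq_mul, mul_one, nsmul_eq_mul] at hn
    refine ⟨(n : ZMod m), ?_⟩
    rw [zmodToQmodZ, ZMod.lift_coe]
    have hm : (m : ℚ) ≠ 0 := Nat.cast_ne_zero.2 (NeZero.ne m)
    change ((((n : ℚ) / m : ℚ)) : AddCircle (1 : ℚ)) = _
    rw [show ((n : ℚ) / m : ℚ) = r by rw [hn]; field_simp]

/-- **Every continuous character of `Γ_F^{ab}` killed on `m`-th powers descends to a finite abelian layer.**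
(`ker(χ̄ ∘ θ)` is open of finite index in `C_F` — `θ` continuous, values `m`-torsion; existence theorem in kernel form
`exists_ker_artinMapFamily_le`; lift along the surjective `ψ̄_{L|F}`.)
[cite: Neukirch2013, Part III Thm. (7.12), (7.8)][cite: CasselsFrohlichANT1967, Ch. VII §5.1 Main Theorem (B), (D)] -/
theorem exists_layerDescent
    (χbar : contOneCocycles (ContinuousRep.trivial (absoluteGaloisGroupAbelianization F) ℤ QModZCoeff.{0}).toTopRep)
    (hχ : ∀ g : absoluteGaloisGroupAbelianization F, χbar.1 (g ^ m) = 0) : Nonempty (LayerDescent m χbar) := by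
  classical
  set θ := (isCompatibleSystem_artinMapFamily (K := F) artinReciprocity_character_holds).theta with hθdef
  have hθ : IsGlobalReciprocityMap F θ := isGlobalReciprocityMap_artinTheta F
  let f : (ideleGroup F ⧸ principalIdeles F) →* Multiplicative QModZCoeff.{0} :=
    (contOneCocycles.toMonoidHomOfTrivial χbar).comp θ
  have hf : ∀ c, f c = Multiplicative.ofAdd (χbar.1 (θ c)) := fun c => rfl
  have hcont : Continuous f := (continuous_ofAdd.comp χbar.1.continuous).comp hθ.continuous
  have hopen : IsOpen (f.ker : Set (ideleGroup F ⧸ principalIdeles F)) := by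
    have : (f.ker : Set (ideleGroup F ⧸ principalIdeles F)) = f ⁻¹' {1} := by
      ext c; simp [MonoidHom.mem_ker]
    rw [this]
    exact (isOpen_discrete ({1} : Set (Multiplicative QModZCoeff.{0}))).preimage hcont
  have hval : ∀ c, ∃ k : ZMod m, zmodToQmodZ m k = (χbar.1 (θ c)).down := fun c => by
    refine exists_zmodToQmodZ_eq_of_nsmul_eq_zero' m ?_
    have h2 := congrArg Multiplicative.toAdd (map_pow (contOneCocycles.toMonoidHomOfTrivial χbar) (θ c) m)
    rw [contOneCocycles.toMonoidHomOfTrivial_apply, contOneCocycles.toMonoidHomOfTrivial_apply, toAdd_ofAdd,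
      toAdd_pow, toAdd_ofAdd, hχ (θ c)] at h2
    exact congrArg ULift.down h2.symm
  have hfin : (Set.range f).Finite := by
    refine (Set.finite_range fun k : ZMod m =>
      Multiplicative.ofAdd (ULift.up.{0} (zmodToQmodZ m k) : QModZCoeff.{0})).subset ?_
    rintro _ ⟨c, rfl⟩
    obtain ⟨k, hk⟩ := hval c
    refine ⟨k, ?_⟩
    show Multiplicative.ofAdd (ULift.up.{0} (zmodToQmodZ m k) : QModZCoeff.{0}) = f c
    rw [hk, ULift.up_down, hf c]
    rfl
  haveI : Finite f.range := hfin.to_subtype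
  haveI : Finite ((ideleGroup F ⧸ principalIdeles F) ⧸ f.ker) :=
    Finite.of_equiv f.range (QuotientGroup.quotientKerEquivRange f).symm.toEquiv
  have hfi : f.ker.FiniteIndex := Subgroup.finiteIndex_of_finite_quotient
  obtain ⟨L, hLfd, hLab, hker⟩ := exists_ker_artinMapFamily_le f.ker hopen hfi
  haveI := hLfd
  haveI := hLab
  have hsurj : Surjective (artinMapFamily F artinReciprocity_character_holds L) :=
    artinMapFamily_surjective artinReciprocity_character_holds L
  let g : (L ≃ₐ[F] L) →* Multiplicative QModZCoeff.{0} :=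
    (artinMapFamily F artinReciprocity_character_holds L).liftOfSurjective hsurj ⟨f, hker⟩
  have hg : ∀ c, g (artinMapFamily F artinReciprocity_character_holds L c) = f c := fun c =>
    (artinMapFamily F artinReciprocity_character_holds L).liftOfRightInverse_comp_apply _ _ ⟨f, hker⟩ c
  have hgval : ∀ σ : L ≃ₐ[F] L, ∃ k : ZMod m, zmodToQmodZ m k = (Multiplicative.toAdd (g σ)).down := fun σ => by
    obtain ⟨c, rfl⟩ := hsurj σ
    rw [hg, hf]
    exact hval c
  choose k hk using hgval
  have hkadd : ∀ σ τ, k (σ * τ) = k σ + k τ := fun σ τ => by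
    apply zmodToQmodZ_injective m
    rw [map_add, hk, hk, hk, map_mul, toAdd_mul]
    rfl
  let χL : Additive (L ≃ₐ[F] L) →+ ZMod m :=
    AddMonoidHom.mk' (fun a => k (Additive.toMul a)) (fun a b => hkadd (Additive.toMul a) (Additive.toMul b))
  refine ⟨⟨L, hLfd, hLab, χL, fun c => ?_⟩⟩
  change zmodToQmodZ m (k (artinMapFamily F artinReciprocity_character_holds L c)) = _
  rw [hk, hg, hf, toAdd_ofAdd]

variable {m}

/-- **The values of a descent on `Γ_F`**: `χ(γ|_L)/m = χ̄(γ̄)` for every `γ ∈ Γ_F` (`θ` is onto, and `θ(c) = γ̄` forces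
`γ|_L = ψ̄_{L|F}(c)`, `restrictNormalHom_eq_of_absGaloisAbProj_eq`). [cite: Neukirch2013, Part III §6 (6.13), (6.14)] -/
theorem LayerDescent.apply_absRestrictNormalHom
    {χbar : contOneCocycles (ContinuousRep.trivial (absoluteGaloisGroupAbelianization F) ℤ QModZCoeff.{0}).toTopRep}
    (d : LayerDescent m χbar) (γ : absoluteGaloisGroup F) :
    haveI := d.fd; haveI := d.ab
    zmodToQmodZ m (d.χ (Additive.ofMul (absRestrictNormalHom d.L γ))) = (χbar.1 (absGaloisAbProj F γ)).down := by
  haveI := d.fd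
  haveI := d.ab
  obtain ⟨c, hc⟩ := artinTheta_surjective F (absGaloisAbProj F γ)
  have hres := (isCompatibleSystem_artinMapFamily (K := F) artinReciprocity_character_holds).restrictNormalHom_eq_of_absGaloisAbProj_eq
    hc.symm d.L
  change zmodToQmodZ m (d.χ (Additive.ofMul (AlgEquiv.restrictNormalHom d.L (absoluteGaloisGroup.toAlgEquiv F γ)))) = _
  rw [hres, d.spec c, hc]

/-- **A layer character descends its own character of `Γ_F^{ab}`** (`layerCharacter`): for every idèle class `c` and any
`γ` with `γ̄ = θ c`, `χ(ψ̄_{L|F} c) = χ(γ|_L)`. [cite: Neukirch2013, Part III §6 (6.13), (6.14)] -/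
def layerDescentSelf (m : ℕ) [NeZero m] (L : IntermediateField F (AlgebraicClosure F)) [FiniteDimensional F L]
    [IsAbelianGalois F L] (χ : Additive (L ≃ₐ[F] L) →+ ZMod m) : LayerDescent m (layerCharacter m L χ) where
  L := L
  fd := inferInstance
  ab := inferInstance
  χ := χ
  spec c := by
    obtain ⟨γ, hγ, -⟩ :=
      (isCompatibleSystem_artinMapFamily (K := F) artinReciprocity_character_holds).exists_absGaloisAbProj_eq_theta c
    have hres := (isCompatibleSystem_artinMapFamily (K := F) artinReciprocity_character_holds).restrictNormalHom_eq_of_absGaloisAbProj_eq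
      hγ L
    rw [← hγ, layerCharacter_apply_absGaloisAbProj]
    change zmodToQmodZ m (χ (Additive.ofMul (artinMapFamily F artinReciprocity_character_holds L c))) =
      zmodToQmodZ m (χ (Additive.ofMul (AlgEquiv.restrictNormalHom L (absoluteGaloisGroup.toAlgEquiv F γ))))
    rw [hres]

end Descent

/-! ## §3. The functional on the characters killed by `m`, through the chosen descents -/

section Functional

variable (F) (m : ℕ) [NeZero m]

/-- The continuous characters of `Γ_F^{ab}` killed on `m`-th powers (`= Hom_cont(Γ_F^{ab}, ℤ/m)` inside
`Hom_cont(Γ_F^{ab}, ℚ/ℤ)`). [cite: SerreLocalFields1979, XIII §1] -/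
def powKilledCharacters :
    AddSubgroup (contOneCocycles (ContinuousRep.trivial (absoluteGaloisGroupAbelianization F) ℤ QModZCoeff.{0}).toTopRep) where
  carrier := {χbar | ∀ g : absoluteGaloisGroupAbelianization F, χbar.1 (g ^ m) = 0}
  zero_mem' := fun _ => rfl
  add_mem' := fun {a b} ha hb g => by
    change a.1 (g ^ m) + b.1 (g ^ m) = 0
    rw [ha g, hb g, add_zero]
  neg_mem' := fun {a} ha g => by
    change -(a.1 (g ^ m)) = 0
    rw [ha g, neg_zero]

variable {F m}

omit [NumberField F] [NeZero m] in
/-- Membership in `powKilledCharacters`. [cite: SerreLocalFields1979, XIII §1] -/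
theorem mem_powKilledCharacters_iff
    (χbar : contOneCocycles (ContinuousRep.trivial (absoluteGaloisGroupAbelianization F) ℤ QModZCoeff.{0}).toTopRep) :
    χbar ∈ powKilledCharacters F m ↔ ∀ g : absoluteGaloisGroupAbelianization F, χbar.1 (g ^ m) = 0 := Iff.rfl

/-- A chosen layer descent of a character killed on `m`-th powers. [cite: Neukirch2013, Part III Thm. (7.12)] -/
def someDescent (a : powKilledCharacters F m) :
    LayerDescent m (a : contOneCocycles (ContinuousRep.trivial (absoluteGaloisGroupAbelianization F) ℤ QModZCoeff.{0}).toTopRep) :=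
  Classical.choice (exists_layerDescent m _ a.2)

variable (Φ : (L : IntermediateField F (AlgebraicClosure F)) → (Additive (L ≃ₐ[F] L) →+ ZMod m) → ZMod m)

/-- The value of the family `Φ` on the chosen descent of a character. [cite: MilneADT2006, Ch. I Thm. 1.8 (b)] -/
def descentValue (a : powKilledCharacters F m) : ZMod m :=
  Φ (someDescent a).L (someDescent a).χ

variable (hcompat : ∀ (L L' : IntermediateField F (AlgebraicClosure F)) [FiniteDimensional F L] [IsAbelianGalois F L]
      [FiniteDimensional F L'] [IsAbelianGalois F L']
      (χ : Additive (L ≃ₐ[F] L) →+ ZMod m) (χ' : Additive (L' ≃ₐ[F] L') →+ ZMod m),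
      (∀ γ : absoluteGaloisGroup F,
        χ (Additive.ofMul (absRestrictNormalHom L γ)) = χ' (Additive.ofMul (absRestrictNormalHom L' γ))) →
      Φ L χ = Φ L' χ')

include hcompat in
/-- **`Φ` takes the same value on any two descents of the same character** (compatibility read on `Γ_F`).
[cite: MilneADT2006, Ch. I Thm. 1.8 (b)] -/
theorem descentValue_eq_of_layerDescent (a : powKilledCharacters F m)
    (d : LayerDescent m (a : contOneCocycles (ContinuousRep.trivial (absoluteGaloisGroupAbelianization F) ℤ QModZCoeff.{0}).toTopRep)) :
    descentValue Φ a = Φ d.L d.χ := by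
  haveI := (someDescent a).fd; haveI := (someDescent a).ab; haveI := d.fd; haveI := d.ab
  refine hcompat (someDescent a).L d.L (someDescent a).χ d.χ fun γ => zmodToQmodZ_injective m ?_
  exact ((someDescent a).apply_absRestrictNormalHom γ).trans (d.apply_absRestrictNormalHom γ).symm

variable (hadd : ∀ (L : IntermediateField F (AlgebraicClosure F)) [FiniteDimensional F L] [IsAbelianGalois F L]
      (χ χ' : Additive (L ≃ₐ[F] L) →+ ZMod m), Φ L (χ + χ') = Φ L χ + Φ L χ')

omit [NumberField F] [NeZero m] in
include hadd in
/-- `Φ L 0 = 0`. [cite: MilneADT2006, Ch. I Thm. 1.8 (b)] -/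
theorem apply_zero_eq_zero (L : IntermediateField F (AlgebraicClosure F)) [FiniteDimensional F L] [IsAbelianGalois F L] :
    Φ L (0 : Additive (L ≃ₐ[F] L) →+ ZMod m) = 0 := by
  have h := hadd L 0 0
  rw [add_zero] at h
  exact left_eq_add.1 h

include hadd hcompat in
/-- **The descent value is additive**: move both descents and the descent of the sum to the compositum `L_a ⊔ L_b`
(finite abelian, the tree's `isAbelianGalois_sup`) along `exists_comp_absRestrictNormalHom_eq`, where `Φ` is additive.
[cite: MilneADT2006, Ch. I Thm. 1.8 (b)][cite: SerreLocalFields1979, XIII §1] -/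
theorem descentValue_add (a b : powKilledCharacters F m) :
    descentValue Φ (a + b) = descentValue Φ a + descentValue Φ b := by
  let da := someDescent a
  let db := someDescent b
  let dab := someDescent (a + b)
  haveI := da.fd; haveI := da.ab; haveI := db.fd; haveI := db.ab; haveI := dab.fd; haveI := dab.ab
  let L' : IntermediateField F (AlgebraicClosure F) := da.L ⊔ db.L
  haveI : FiniteDimensional F L' := IntermediateField.finiteDimensional_sup da.L db.L
  haveI : IsAbelianGalois F L' := isAbelianGalois_sup da.L db.L
  obtain ⟨πa, hπa⟩ := exists_comp_absRestrictNormalHom_eq da.L (le_sup_left : da.L ≤ L')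
  obtain ⟨πb, hπb⟩ := exists_comp_absRestrictNormalHom_eq db.L (le_sup_right : db.L ≤ L')
  let χa' : Additive (L' ≃ₐ[F] L') →+ ZMod m := da.χ.comp (MonoidHom.toAdditive πa)
  let χb' : Additive (L' ≃ₐ[F] L') →+ ZMod m := db.χ.comp (MonoidHom.toAdditive πb)
  have ha : Φ da.L da.χ = Φ L' χa' := hcompat _ _ _ _ fun γ =>
    congrArg (fun t => da.χ (Additive.ofMul t)) (hπa γ).symm
  have hb : Φ db.L db.χ = Φ L' χb' := hcompat _ _ _ _ fun γ =>
    congrArg (fun t => db.χ (Additive.ofMul t)) (hπb γ).symm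
  have hab : Φ dab.L dab.χ = Φ L' (χa' + χb') := hcompat _ _ _ _ fun γ => by
    apply zmodToQmodZ_injective m
    have e1 := dab.apply_absRestrictNormalHom γ
    have e2 := da.apply_absRestrictNormalHom γ
    have e3 := db.apply_absRestrictNormalHom γ
    have e4 : zmodToQmodZ m ((χa' + χb') (Additive.ofMul (absRestrictNormalHom L' γ))) =
        zmodToQmodZ m (da.χ (Additive.ofMul (absRestrictNormalHom da.L γ))) +
          zmodToQmodZ m (db.χ (Additive.ofMul (absRestrictNormalHom db.L γ))) := by
      exact (map_add (zmodToQmodZ m) _ _).trans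
        (congrArg₂ (· + ·) (congrArg (fun t => zmodToQmodZ m (da.χ (Additive.ofMul t))) (hπa γ))
          (congrArg (fun t => zmodToQmodZ m (db.χ (Additive.ofMul t))) (hπb γ)))
    have e5 : (((a + b : powKilledCharacters F m) :
          contOneCocycles (ContinuousRep.trivial (absoluteGaloisGroupAbelianization F) ℤ QModZCoeff.{0}).toTopRep).1
          (absGaloisAbProj F γ)).down =
        ((a : contOneCocycles (ContinuousRep.trivial (absoluteGaloisGroupAbelianization F) ℤ QModZCoeff.{0}).toTopRep).1
            (absGaloisAbProj F γ)).down +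
          ((b : contOneCocycles (ContinuousRep.trivial (absoluteGaloisGroupAbelianization F) ℤ QModZCoeff.{0}).toTopRep).1
            (absGaloisAbProj F γ)).down := rfl
    exact e1.trans (e5.trans ((congrArg₂ (· + ·) e2.symm e3.symm).trans e4.symm))
  change Φ dab.L dab.χ = Φ da.L da.χ + Φ db.L db.χ
  exact hab.trans ((hadd L' χa' χb').trans (congrArg₂ (· + ·) ha.symm hb.symm))

/-- **The functional `χ̄ ↦ Φ(descent of χ̄)` on the characters of `Γ_F^{ab}` killed on `m`-th powers.**
[cite: MilneADT2006, Ch. I Thm. 1.8 (b)] -/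
def descentFunctional : powKilledCharacters F m →+ ZMod m where
  toFun := descentValue Φ
  map_zero' := by
    haveI := (someDescent (0 : powKilledCharacters F m)).fd
    haveI := (someDescent (0 : powKilledCharacters F m)).ab
    have h0 : descentValue Φ 0 = Φ (someDescent (0 : powKilledCharacters F m)).L 0 := by
      refine hcompat _ _ _ _ fun γ => zmodToQmodZ_injective m ?_
      exact ((someDescent (0 : powKilledCharacters F m)).apply_absRestrictNormalHom γ).trans
        (map_zero (zmodToQmodZ m)).symm
    exact h0.trans (apply_zero_eq_zero Φ hadd _)
  map_add' := descentValue_add Φ hcompat hadd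

/-- Unfolding: `descentFunctional a = Φ` of ANY descent of `a`. [cite: MilneADT2006, Ch. I Thm. 1.8 (b)] -/
theorem descentFunctional_apply_eq_of_layerDescent (a : powKilledCharacters F m)
    (d : LayerDescent m (a : contOneCocycles (ContinuousRep.trivial (absoluteGaloisGroupAbelianization F) ℤ QModZCoeff.{0}).toTopRep)) :
    descentFunctional Φ hcompat hadd a = Φ d.L d.χ :=
  descentValue_eq_of_layerDescent Φ hcompat a d

end Functional

/-! ## §4. Surjectivity of `α¹(Γ_F, ℤ/m)` at the layers -/

section Surjectivity

/-- **Every compatible additive family of functionals on the `ℤ/m`-characters of the finite abelian layers is evaluation at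
`ψ_{L|F}(x)` for one idèle `x`.**  Let `m ≥ 1` and let `Φ_L : Hom(Gal(L/F), ℤ/m) → ℤ/m` (`L ⊆ F̄` finite abelian) be
additive in `χ` and compatible: `Φ_L χ = Φ_{L'} χ'` whenever `χ(γ|_L) = χ'(γ|_{L'})` for all `γ ∈ Γ_F`.  Then there is an
idèle `x` of `F` with `Φ_L χ = χ(ψ_{L|F} x)` for every `L` and `χ` — the surjectivity of Milne's
`α¹(Γ_F, ℤ/m) : C_F/m → H¹(Γ_F, ℤ/m)^*` for the idèle class formation, with `H¹(Γ_F, ℤ/m) = ⋃_L Hom(Gal(L/F), ℤ/m)`.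
[cite: MilneADT2006, Ch. I Thm. 1.8 (b)][cite: SerreLocalFields1979, XIII §1][cite: Neukirch2013, Part III Thm. (7.12)] -/
theorem exists_idele_forall_layer_character_eq {m : ℕ} (hm : 0 < m)
    (Φ : (L : IntermediateField F (AlgebraicClosure F)) → (Additive (L ≃ₐ[F] L) →+ ZMod m) → ZMod m)
    (hadd : ∀ (L : IntermediateField F (AlgebraicClosure F)) [FiniteDimensional F L] [IsAbelianGalois F L]
      (χ χ' : Additive (L ≃ₐ[F] L) →+ ZMod m), Φ L (χ + χ') = Φ L χ + Φ L χ')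
    (hcompat : ∀ (L L' : IntermediateField F (AlgebraicClosure F)) [FiniteDimensional F L] [IsAbelianGalois F L]
      [FiniteDimensional F L'] [IsAbelianGalois F L']
      (χ : Additive (L ≃ₐ[F] L) →+ ZMod m) (χ' : Additive (L' ≃ₐ[F] L') →+ ZMod m),
      (∀ γ : absoluteGaloisGroup F,
        χ (Additive.ofMul (absRestrictNormalHom L γ)) = χ' (Additive.ofMul (absRestrictNormalHom L' γ))) →
      Φ L χ = Φ L' χ') :
    ∃ x : ideleGroup F, ∀ (L : IntermediateField F (AlgebraicClosure F)) (_ : FiniteDimensional F L)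
      (_ : IsAbelianGalois F L) (χ : Additive (L ≃ₐ[F] L) →+ ZMod m),
      haveI : NumberField L := NumberField.of_module_finite F L
      Φ L χ = χ (Additive.ofMul (artinIdeleMap L artinReciprocity_character_holds x)) := by
  classical
  haveI : NeZero m := ⟨hm.ne'⟩
  haveI : CompactSpace (absoluteGaloisGroup F) := absoluteGaloisGroup_compactSpace F
  -- extend `descentFunctional/m : Xm → ℚ/ℤ` to all continuous characters of `Γ_F^{ab}` (injectivity of `ℚ/ℤ`)
  let Xm := powKilledCharacters F m
  let ψ₀ : Xm →+ ZMod m := descentFunctional Φ hcompat hadd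
  let ψ₀' : CharacterModule Xm := (zmodToQmodZ m).comp ψ₀
  obtain ⟨ψ₁, hψ₁⟩ := CharacterModule.dual_surjective_of_injective (Xm.subtype.toIntLinearMap)
    (fun a b h => Subtype.ext h) ψ₀'
  have hψ₁' : ∀ a : Xm,
      ψ₁ (a : contOneCocycles (ContinuousRep.trivial (absoluteGaloisGroupAbelianization F) ℤ QModZCoeff.{0}).toTopRep) =
        zmodToQmodZ m (ψ₀ a) := fun a =>
    congrArg (fun c : CharacterModule Xm => c a) hψ₁
  let ψ : contOneCocycles (ContinuousRep.trivial (absoluteGaloisGroupAbelianization F) ℤ QModZCoeff.{0}).toTopRep →+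
      QModZCoeff.{0} :=
    { toFun := fun χbar => ULift.up (ψ₁ χbar)
      map_zero' := by rw [map_zero]; rfl
      map_add' := fun a b => by rw [map_add]; rfl }
  -- Pontryagin: `ψ` is evaluation at a point `g = θ(x̄)`
  obtain ⟨g, hg⟩ := exists_forall_character_apply_eq ψ
  obtain ⟨c₀, hc₀⟩ := artinTheta_surjective F g
  obtain ⟨x, rfl⟩ := QuotientGroup.mk_surjective c₀
  refine ⟨x, fun L hL hab χ => ?_⟩
  haveI := hL
  haveI := hab
  haveI : NumberField L := NumberField.of_module_finite F L
  -- the character of `Γ_F^{ab}` attached to `(L, χ)` lies in `Xm` and is descended by `(L, χ)` itself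
  let a : Xm := ⟨layerCharacter m L χ, layerCharacter_pow_eq_zero m L χ⟩
  have h1 : ψ₀ a = Φ L χ := descentFunctional_apply_eq_of_layerDescent Φ hcompat hadd a (layerDescentSelf m L χ)
  -- evaluate `ψ` at `a` in two ways
  have h2 : (ψ (a : contOneCocycles _)).down = zmodToQmodZ m (Φ L χ) := by
    change ψ₁ (a : contOneCocycles _) = _
    rw [hψ₁' a, h1]
  have h3 : (ψ (a : contOneCocycles _)).down =
      zmodToQmodZ m (χ (Additive.ofMul (artinIdeleMap L artinReciprocity_character_holds x))) := by
    rw [hg, ← hc₀]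
    change ((layerCharacter m L χ).1
      ((isCompatibleSystem_artinMapFamily (K := F) artinReciprocity_character_holds).theta (QuotientGroup.mk x))).down = _
    rw [← (layerDescentSelf m L χ).spec (QuotientGroup.mk x)]
    change zmodToQmodZ m (χ (Additive.ofMul (artinMapFamily F artinReciprocity_character_holds L (QuotientGroup.mk x)))) = _
    rw [artinMapFamily_eq artinReciprocity_character_holds L, artinClassMap_mk]
  exact zmodToQmodZ_injective m (h2.symm.trans h3)

end Surjectivity

end Literature.NumberTheory.GaloisRepresentations

end
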